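import Literature.Geometry.Lorentzian.KlainermanSzeftel2021.Setup
import Literature.Geometry.Lorentzian.KlainermanSzeftel2021.Dag
import Literature.Geometry.Lorentzian.KlainermanSzeftel2021.Bootstrap
import Literature.Geometry.Lorentzian.KlainermanSzeftel2021.Bridge

/-!
# Klainerman–Szeftel, *Kerr stability for small angular momentum*: the bridge `Setup ⟶ KSArchitecture`, `Setup.PTData ⟶ Ch9Iteration`

CITATION HEADER (lean-in-tree rule 2026-08-18). Sources as in the imported modules: S. Klainerman, J. Szeftel, arXiv:2104.11857 (v1, 2021)
= bib key `KlainermanSzeftel2021`, journal version Pure Appl. Math. Q. **19** (2023) no. 3, 791–1678 = `KlainermanSzeftel2023` (refereed record);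
`TeX l.N` = lines of the arXiv TeX source; `GKS` = E. Giorgi, S. Klainerman, J. Szeftel arXiv:2205.14808 (journal Pure Appl. Math. Q. **20** (2024)
no. 7), used only for the location of the iteration parameter `ε_J` ((13.6.4), TeX l.25920–25925).

WHAT THIS FILE IS. The second half of `Bridge.lean` (split so that the first half did not wait for `Dag.lean`): NOT a route, NOT a result about
the Einstein equations, NO fact of the paper asserted. It INSTANTIATES the two field-stable carrier records of `Dag.lean` from the concrete
schematic objects of `Setup.lean`: `Bridge.architectureOf : KSArchitecture` (KS §3.5–3.7: the realized GCM admissible spacetimes, `u_*`, `r_*`,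
the eight regional norms read through `Bootstrap.trunc`, the opaque inputs of `Bridge.Inputs`; `D_mono` discharged by Setup's theorems) with
`memAleph_of_inAleph` / `𝒰_subset_calU` (Setup's `ℵ(u)`/`𝒰` sit inside the architecture's — the converse fails exactly by the parameter
clause the printed Def. 3.7.1 omits), and `Bridge.ch9Of : Ch9Iteration` (KS §9.4: the PT norms `𝔖_k, ℜ_k` and their regional pieces, TeX
l.23858–24040, read in `ℝ` by `ENNReal.toReal` of Setup's `ℝ≥0∞` square roots) with `ch9Of_BAch9_iff` (on FINITE values the abstract bootstrap
assumption `BAch9`, KS (9.4.32) l.24441–24458, IS Setup's `BAPT`), the sum identities `ch9Of_S_eq_sum` / `ch9Of_R_eq_sum` under finiteness,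
and sign lemmas. `ENNReal.toReal ⊤ = 0` is junk: every lemma carries the finiteness hypotheses it needs. Zero `sorry`; axioms ⊆ {propext,
Classical.choice, Quot.sound}; tags `[folklore]` = bookkeeping, `[cite: …]` = provenance of a transcribed display.

STATUS OF THE SOURCE / RELATION TO TREE MATERIAL: as in the headers of the imported modules (KS is refereed; the audit cell `pub-kerr` types its
architecture as hypotheses over data; no relation is claimed to `StabilityCauchy.lean`, `Stability.lean` or the `Kerr*.lean` files).
-/

noncomputable section

open scoped ENNReal

namespace Literature.Geometry.Lorentzian.KlainermanSzeftel2021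

namespace Bridge

open Setup

open Bootstrap (trunc trunc_mono trunc_nonneg)

variable (c : Constants) (M : Spacetime) (Realized : GCMAdmissible c M → Prop)

variable {c M Realized}

/-- **The `KSArchitecture` of Setup** (the field-stable carrier record of `Dag.lean`, KS §3.5–3.7): same recipe as `Bridge.settingOf` —
norms read through `Bootstrap.trunc`, `ε0_pos` from `Exact`, `D_mono` DISCHARGED by Setup's monotonicity theorems. [folklore] -/
def architectureOf (hE : c.Exact) (I : Inputs c M Realized) : KSArchitecture where
  Sp := Sp c M Realized
  ustar X := X.1.uStar
  rstar X := X.1.rStar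
  m0 := c.m₀
  a0 := c.a₀
  ε0 := c.ε₀
  δstar := c.δstar
  δdec := c.δdec
  kLarge := c.kLarge
  Bstar X k := trunc (X.1.BStar k)
  Bext X k := trunc (X.1.BExt k)
  Bint X k := trunc (X.1.BInt k)
  Btop X k := trunc (X.1.BTop k)
  Dstar X k := trunc (X.1.DStar k)
  Dext X k := trunc (X.1.DExt k)
  Dint X k := trunc (X.1.DInt k)
  Dtop X k := trunc (X.1.DTop k)
  Extends := I.Extends
  M7Ext := I.BuiltByM7
  M1Concl := I.M1Concl
  M2Concl := I.M2Concl
  MainConcl := I.MainConcl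
  ε0_pos := hE.ε₀_pos
  D_mono X := ⟨trunc_mono.comp X.1.DStar_mono, trunc_mono.comp X.1.DExt_mono, trunc_mono.comp X.1.DInt_mono,
    trunc_mono.comp X.1.DTop_mono⟩

section Consistency

variable (I : Inputs c M Realized)

/-- `KSArchitecture.MemAleph` (which follows the PRINTED Def. 3.7.1, KS l.6744–6760, and omits the parameter clause `|m-m₀|+|a-a₀| ≲ ε m₀`
that Setup's `InAleph` carries inside BA-B, cf. the cell's DIVERGENCE SRC-01) is implied by Setup's `InAleph`; the converse fails by
exactly that clause. [cite: KlainermanSzeftel2021, TeX l.6744–6760] -/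
theorem memAleph_of_inAleph (hE : c.Exact) (hε1 : c.ε < 1) (u : ℝ) (X : Sp c M Realized) (h : X.1.InAleph u) :
    (architectureOf hE I).MemAleph u X := by
  have hε0 : 0 ≤ c.ε := hE.ε_pos.le
  have hεA : (architectureOf hE I).ε = c.ε := by
    show c.ε₀ ^ ((2 : ℝ) / 3) = c.ε
    exact hE.ε_eq.symm
  refine ⟨h.uStar_eq, h.dominance, ?_, ?_⟩
  · -- BA-B without the parameter clause
    show trunc _ + trunc _ + trunc _ + trunc _ ≤ (architectureOf hE I).ε
    rw [hεA, Bootstrap.trunc_add_four_le_iff hε0 hε1]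
    exact le_trans le_self_add h.baB
  · show trunc _ + trunc _ + trunc _ + trunc _ ≤ (architectureOf hE I).ε
    rw [hεA, Bootstrap.trunc_add_four_le_iff hε0 hε1]
    exact h.baD

/-- Hence Setup's `𝒰` is contained in the `calU` of the architecture instance. [folklore] -/
theorem 𝒰_subset_calU (hE : c.Exact) (hε1 : c.ε < 1) : 𝒰 c M Realized ⊆ (architectureOf hE I).calU := by
  rintro u ⟨hu, 𝓜, hR, h𝓜⟩
  exact ⟨hu, ⟨𝓜, hR⟩, memAleph_of_inAleph I hE hε1 u ⟨𝓜, hR⟩ h𝓜⟩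

end Consistency

/-! ### The chapter-9 iteration record `Ch9Iteration` of `Dag.lean` from concrete PT data (`Setup.GCMAdmissible.PTData`)

`Ch9Iteration` is real-valued; the PT norms of Setup §15 are `ℝ≥0∞`-valued squares.  The instance takes `.toReal` of the square roots, which is
exact on FINITE values (`ENNReal.toReal ⊤ = 0` is junk): every bridge lemma below carries the finiteness hypotheses it needs (the cell's DIVERGENCE DV-17(d)).
`ε_J` (GKS (13.6.4), "such that `𝔖_J + ℜ_J ≤ ε_J`", l.25920–25925) is a free parameter of the iteration and stays an argument. -/

section Ch9

/-- the `Ch9Iteration` record of PT data `𝓟` on a GCM admissible spacetime [folklore] -/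
def ch9Of {𝓜 : GCMAdmissible c M} (𝓟 : 𝓜.PTData) (epsJ : ℕ → ℝ) : Ch9Iteration where
  ε0 := c.ε₀
  ε := c.ε
  r0 := c.r₀
  a := 𝓜.params.a
  δB := c.δB
  kLarge := c.kLarge
  S k := (𝓟.Sk k).toReal
  R k := (𝓟.Rk k).toReal
  Sstar k := (GCMAdmissible.PTData.sqrt' (𝓟.SkStarSq k)).toReal
  Sext k := (GCMAdmissible.PTData.sqrt' (𝓟.SkExtSq k)).toReal
  Sint k := (GCMAdmissible.PTData.sqrt' (𝓟.SkIntSq k)).toReal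
  Stop k := (GCMAdmissible.PTData.sqrt' (𝓟.SkTopSq k)).toReal
  StopFar k := (GCMAdmissible.PTData.sqrt' (𝓟.SkTopFarSq k)).toReal
  Rstar k := (GCMAdmissible.PTData.sqrt' (𝓟.RkStarSq k)).toReal
  Rext k := (GCMAdmissible.PTData.sqrt' (𝓟.RkExtSq k)).toReal
  Rint k := (GCMAdmissible.PTData.sqrt' (𝓟.RkIntSq k)).toReal
  Rtop k := (GCMAdmissible.PTData.sqrt' (𝓟.RkTopSq k)).toReal
  L k := (GCMAdmissible.PTData.sqrt' (𝓟.LStarSq k)).toReal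
  epsJ := epsJ

variable {𝓜 : GCMAdmissible c M} (𝓟 : 𝓜.PTData) (epsJ : ℕ → ℝ)

/-- `𝔖_k` of the record is `(Setup 𝔖_k).toReal`. [folklore] -/
@[simp] theorem ch9Of_S (k : ℕ) : (ch9Of 𝓟 epsJ).S k = (𝓟.Sk k).toReal := rfl
/-- `ℜ_k` of the record is `(Setup ℜ_k).toReal`. [folklore] -/
@[simp] theorem ch9Of_R (k : ℕ) : (ch9Of 𝓟 epsJ).R k = (𝓟.Rk k).toReal := rfl
/-- `k_large` agrees. [folklore] -/
@[simp] theorem ch9Of_kLarge : (ch9Of 𝓟 epsJ).kLarge = c.kLarge := rfl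
/-- `ε` agrees. [folklore] -/
@[simp] theorem ch9Of_ε : (ch9Of 𝓟 epsJ).ε = c.ε := rfl
/-- `ε₀` agrees. [folklore] -/
@[simp] theorem ch9Of_ε0 : (ch9Of 𝓟 epsJ).ε0 = c.ε₀ := rfl

/-- `k_L = k_large + 7` of the record is the constant of Setup [folklore] -/
theorem ch9Of_kL : (ch9Of 𝓟 epsJ).kL = c.kLarge + 7 := rfl

/-- On finite values the abstract bootstrap assumption `BAch9` of `Dag` (KS (9.4.32)) IS Setup's `BAPT`. [folklore] -/
theorem ch9Of_BAch9_iff (hS : 𝓟.Sk (c.kLarge + 7) ≠ ⊤) (hR : 𝓟.Rk (c.kLarge + 7) ≠ ⊤) (hε : 0 ≤ c.ε) :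
    (ch9Of 𝓟 epsJ).BAch9 ↔ 𝓟.BAPT := by
  unfold Ch9Iteration.BAch9 GCMAdmissible.PTData.BAPT
  simp only [ch9Of_S, ch9Of_R, ch9Of_kLarge, ch9Of_ε]
  rw [← ENNReal.toReal_add hS hR, ← ENNReal.le_ofReal_iff_toReal_le (ENNReal.add_ne_top.2 ⟨hS, hR⟩) hε]

/-- On finite values, `S k` of the record is the sum of its four regional parts (KS l.24001–24006 is the DEFINITION of `𝔖_k` in Setup §15). [cite: KlainermanSzeftel2021, TeX l.24001–24006] -/
theorem ch9Of_S_eq_sum (k : ℕ)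
    (h1 : GCMAdmissible.PTData.sqrt' (𝓟.SkStarSq k) ≠ ⊤) (h2 : GCMAdmissible.PTData.sqrt' (𝓟.SkExtSq k) ≠ ⊤)
    (h3 : GCMAdmissible.PTData.sqrt' (𝓟.SkIntSq k) ≠ ⊤) (h4 : GCMAdmissible.PTData.sqrt' (𝓟.SkTopSq k) ≠ ⊤) :
    (ch9Of 𝓟 epsJ).S k
      = (ch9Of 𝓟 epsJ).Sstar k + (ch9Of 𝓟 epsJ).Sext k + (ch9Of 𝓟 epsJ).Sint k + (ch9Of 𝓟 epsJ).Stop k := by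
  show (𝓟.Sk k).toReal = _
  unfold GCMAdmissible.PTData.Sk
  rw [ENNReal.toReal_add (ENNReal.add_ne_top.2 ⟨ENNReal.add_ne_top.2 ⟨h1, h2⟩, h3⟩) h4,
    ENNReal.toReal_add (ENNReal.add_ne_top.2 ⟨h1, h2⟩) h3, ENNReal.toReal_add h1 h2]
  rfl

/-- on finite values, `R k` of the record is the sum of its four regional parts, `ℜ_k = ℜ^*_k + (ext)ℜ_k + (int)ℜ_k + (top)ℜ_k` read in `ℝ` ([KS] l.24001–24006, the DEFINITION of `ℜ_k` transcribed as `Setup.GCMAdmissible.PTData.Rk`). [cite: KlainermanSzeftel2021, TeX l.24001–24006] -/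
theorem ch9Of_R_eq_sum (k : ℕ)
    (h1 : GCMAdmissible.PTData.sqrt' (𝓟.RkStarSq k) ≠ ⊤) (h2 : GCMAdmissible.PTData.sqrt' (𝓟.RkExtSq k) ≠ ⊤)
    (h3 : GCMAdmissible.PTData.sqrt' (𝓟.RkIntSq k) ≠ ⊤) (h4 : GCMAdmissible.PTData.sqrt' (𝓟.RkTopSq k) ≠ ⊤) :
    (ch9Of 𝓟 epsJ).R k
      = (ch9Of 𝓟 epsJ).Rstar k + (ch9Of 𝓟 epsJ).Rext k + (ch9Of 𝓟 epsJ).Rint k + (ch9Of 𝓟 epsJ).Rtop k := by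
  show (𝓟.Rk k).toReal = _
  unfold GCMAdmissible.PTData.Rk
  rw [ENNReal.toReal_add (ENNReal.add_ne_top.2 ⟨ENNReal.add_ne_top.2 ⟨h1, h2⟩, h3⟩) h4,
    ENNReal.toReal_add (ENNReal.add_ne_top.2 ⟨h1, h2⟩) h3, ENNReal.toReal_add h1 h2]
  rfl

/-- the record's norms are nonnegative reals (sign bookkeeping for the absorptions of `IterationAbsorption.lean`) [folklore] -/
theorem ch9Of_S_nonneg (k : ℕ) : 0 ≤ (ch9Of 𝓟 epsJ).S k := ENNReal.toReal_nonneg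
/-- `0 ≤ ℜ_k`. [folklore] -/
theorem ch9Of_R_nonneg (k : ℕ) : 0 ≤ (ch9Of 𝓟 epsJ).R k := ENNReal.toReal_nonneg
/-- `0 ≤ ⁽ᵉˣᵗ⁾𝔖_k`. [folklore] -/
theorem ch9Of_Sext_nonneg (k : ℕ) : 0 ≤ (ch9Of 𝓟 epsJ).Sext k := ENNReal.toReal_nonneg
/-- `0 ≤ 𝔏_k`. [folklore] -/
theorem ch9Of_L_nonneg (k : ℕ) : 0 ≤ (ch9Of 𝓟 epsJ).L k := ENNReal.toReal_nonneg

end Ch9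

end Bridge

end Literature.Geometry.Lorentzian.KlainermanSzeftel2021

end
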